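import Literature.AnabelianGeometry.EtaleTheta.EtaleThetaClass
import HarnessLib

/-!
# [EtTh] Rmk. 1.10.3 (i): the constant-multiple rigidity of Thm. 1.10 (i) FAILS for the theta quotient `(Π^tp_X)^Θ` —
# the SHEAR automorphisms `g ↦ c(g)·g` move every theta-type class by the constant class `[c]` (proof-only no-go)

S. Mochizuki, *The étale theta function and its Frobenioid-theoretic manifestations* [EtTh], Publ. RIMS **45** (2009),
Rmk. 1.10.3 (i), PRIMS PDF p. 31 (printed 257): «the étale theta function arises as a cohomology class of a certain subgroup
of the “theta quotient” (Π^tp_X)^Θ … On the other hand, the very strong rigidity property of Theorem 1.10, (i), clearly — as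
one may see, for instance, by considering automorphisms of the topological group (Π^tp_X)^Θ — fails to hold if, for instance,
one replaces “Π^tp_C” by the corresponding “theta quotient” (Π^tp_C)^Θ.» [cite: MochizukiEtTh2009, Rmk 1.10.3 (i) p.31].
abc-iut cell, layer L2, node EtTh:Rmk1.10.3(i); seat abc-iut-w5-d029 (gen 9), abc-iut-L2-lead R1106 «RMK1103i-NOGO» (f-128's M12
census: «informal NEGATIVE claim — a claim is a claim»).  PROOF-ONLY: no definition, no instance, no notation, no named fact.

THE AUTOMORPHISMS THE REMARK POINTS AT, and the no-go (OUR kernel bookkeeping over the typed §1 interface `ThetaSetting`):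
* `ThetaSetting.exists_shear` — for every continuous 1-cocycle `c : (Π^tp_X)^Θ → Δ_Θ` (conjugation action, the tree's cocycle
  convention) that is TRIVIAL ON `Δ_Θ` (e.g. any cocycle inflated from `(Π^tp_X)^Θ/Δ_Θ`, such as the Kummer cocycle of a constant
  `u ∈ O_K^×`), the SHEAR `φ_c : g ↦ c(g)·g` is a continuous group AUTOMORPHISM of `(Π^tp_X)^Θ` fixing `Δ_Θ` pointwise and
  congruent to the identity modulo `Δ_Θ` — so it preserves `Δ_Θ`, `(Π^tp_X)^ell`, and every subgroup `H′ ⊇ Δ_Θ` (in particular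
  `(Π^tp_Ÿ)^Θ`): everything the theta-quotient data can see;
* `ThetaSetting.shear_pullback_apply` — for every subgroup `H′ ⊇ Δ_Θ` and every continuous cocycle `z : H′ → Δ_Θ` of THETA TYPE
  (`z|Δ_Θ = id`, the restriction law of Prop. 1.5 (i)/(iii), `logTheta`), the pull-back along the shear is `z(c(g)·g) = c(g)·z(g)`:
  the class is MULTIPLIED BY `[c]` (`shear_pullback_class`);
* `ThetaSetting.rmk1103i_noGo` — ∃-packaged: for every such `c` there is an automorphism of the topological group `(Π^tp_X)^Θ`,
  trivial on `Δ_Θ` and modulo `Δ_Θ`, whose pull-back carries EVERY theta-type class `[z]` on every `H′ ⊇ Δ_Θ` to `[c|H′]·[z]`.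
  Taking `[c|(Π^tp_Ÿ)^Θ] =` the Kummer class of a unit `u` of infinite order, `η̈^Θ ↦ (u·η̈)^Θ` with `u ≠ ±1`: the «determined up to
  ±1» clause of Thm. 1.10 (i) (`Thm110iUnique`, which HOLDS at the models for the genuine `Π^tp_C`-level hypothesis structures,
  e.g. `SettingModel.thm110iUnique_modelχ_anchored`) has NO analogue for automorphisms of the theta quotient.
HONEST DISPLAY: producing, for a GIVEN unit `u`, a cocycle on ALL of `(Π^tp_X)^Θ` with class `kumYdd u` on `(Π^tp_Ÿ)^Θ` is print's
Kummer inflation from `G_K` (a datum over the abstract interface — the tree's `KummerData.kumY`/`kumYdd` live on `(Π^tp_Y)^Θ` /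
`(Π^tp_Ÿ)^Θ` only; not constructed here) — the no-go is therefore stated for EVERY `Δ_Θ`-trivial cocycle `c`.  Nothing of [EtTh] is asserted beyond what is proved; typed ≠ proved; no side taken on [IUTchIII] Cor. 3.12.
-/

namespace Literature.AnabelianGeometry.EtaleTheta

namespace ThetaSetting

open scoped IsMulCommutative

variable {p : ℕ} [Fact p.Prime] (D : ThetaSetting p)

/-- Elements of `Δ_Θ` commute (field `ker_thetaToEll_comm`). [cite: MochizukiEtTh2009, §1 p.12] -/
theorem deltaTheta_comm_of_mem {x y : D.GtpTheta} (hx : x ∈ D.DeltaTheta) (hy : y ∈ D.DeltaTheta) : x * y = y * x :=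
  D.ker_thetaToEll_comm x hx y hy

/-- A `Δ_Θ`-valued cocycle on `(Π^tp_X)^Θ` that is trivial on `Δ_Θ` is invariant under LEFT translation by `Δ_Θ`:
`c(δ·g) = c(g)`. [cite: MochizukiEtTh2009, Rmk 1.10.3 (i) p.31] -/
theorem cocycle_deltaTheta_mul {c : D.GtpTheta → D.DeltaTheta}
    (hmul : ∀ g h : D.GtpTheta, c (g * h) = c g * MulAut.conjNormal g (c h))
    (htriv : ∀ δ : D.GtpTheta, δ ∈ D.DeltaTheta → c δ = 1) {δ : D.GtpTheta} (hδ : δ ∈ D.DeltaTheta) (g : D.GtpTheta) :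
    c (δ * g) = c g := by
  rw [hmul, htriv δ hδ, one_mul]
  apply Subtype.ext
  rw [MulAut.conjNormal_apply, D.deltaTheta_comm_of_mem hδ (c g).2, mul_inv_cancel_right]

/-- **The SHEAR automorphism of the theta quotient** ([EtTh] Rmk. 1.10.3 (i): «automorphisms of the topological group
(Π^tp_X)^Θ»): for every continuous cocycle `c : (Π^tp_X)^Θ → Δ_Θ` trivial on `Δ_Θ`, `g ↦ c(g)·g` is a continuous group
automorphism of `(Π^tp_X)^Θ` that fixes `Δ_Θ` pointwise and is the identity modulo `Δ_Θ`.  (Constructed inside the proof; no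
definition is introduced.) [cite: MochizukiEtTh2009, Rmk 1.10.3 (i) p.31] -/
theorem exists_shear {c : D.GtpTheta → D.DeltaTheta} (hc : Continuous c)
    (hmul : ∀ g h : D.GtpTheta, c (g * h) = c g * MulAut.conjNormal g (c h))
    (htriv : ∀ δ : D.GtpTheta, δ ∈ D.DeltaTheta → c δ = 1) :
    ∃ φ : D.GtpTheta ≃ₜ* D.GtpTheta,
      (∀ g, φ g = (c g : D.GtpTheta) * g) ∧ (∀ δ ∈ D.DeltaTheta, φ δ = δ) ∧ (∀ g, φ g * g⁻¹ ∈ D.DeltaTheta) := by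
  -- `c` at a sheared element
  have hleft : ∀ g : D.GtpTheta, c ((c g : D.GtpTheta) * g) = c g := fun g =>
    D.cocycle_deltaTheta_mul hmul htriv (c g).2 g
  have hleft' : ∀ g : D.GtpTheta, c (((c g : D.GtpTheta))⁻¹ * g) = c g := fun g =>
    D.cocycle_deltaTheta_mul hmul htriv (D.DeltaTheta.inv_mem (c g).2) g
  let e : D.GtpTheta ≃* D.GtpTheta :=
    { toFun := fun g => (c g : D.GtpTheta) * g
      invFun := fun g => ((c g : D.GtpTheta))⁻¹ * g
      left_inv := fun g => by
        change ((c ((c g : D.GtpTheta) * g) : D.GtpTheta))⁻¹ * ((c g : D.GtpTheta) * g) = g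
        rw [hleft, inv_mul_cancel_left]
      right_inv := fun g => by
        change (c (((c g : D.GtpTheta))⁻¹ * g) : D.GtpTheta) * (((c g : D.GtpTheta))⁻¹ * g) = g
        rw [hleft', mul_inv_cancel_left]
      map_mul' := fun g h => by
        rw [hmul, Subgroup.coe_mul, MulAut.conjNormal_apply]
        group }
  refine ⟨{ e with
      continuous_toFun := (continuous_subtype_val.comp hc).mul continuous_id
      continuous_invFun := (continuous_subtype_val.comp hc).inv.mul continuous_id }, fun g => rfl, fun δ hδ => ?_, fun g => ?_⟩
  · change (c δ : D.GtpTheta) * δ = δ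
    rw [htriv δ hδ, Subgroup.coe_one, one_mul]
  · change (c g : D.GtpTheta) * g * g⁻¹ ∈ D.DeltaTheta
    rw [mul_inv_cancel_right]
    exact (c g).2

/-- An automorphism congruent to the identity modulo `Δ_Θ = Ker((Π^tp_X)^Θ ↠ (Π^tp_X)^ell)` induces the IDENTITY on
`(Π^tp_X)^ell` — the shear is invisible to the maximal abelian-by-`G_K` quotient. [cite: MochizukiEtTh2009, Rmk 1.10.3 (i) p.31] -/
theorem thetaToEll_eq_of_mul_inv_mem {φ : D.GtpTheta ≃ₜ* D.GtpTheta} (hmod : ∀ g, φ g * g⁻¹ ∈ D.DeltaTheta)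
    (g : D.GtpTheta) : D.thetaToEll (φ g) = D.thetaToEll g := by
  have h : D.thetaToEll (φ g * g⁻¹) = 1 := hmod g
  rwa [map_mul, map_inv, mul_inv_eq_one] at h

/-- **Pull-back along the shear MULTIPLIES theta-type cocycles by `c`**: for `H′ ⊇ Δ_Θ`, a continuous cocycle `z : H′ → Δ_Θ` with
`z|Δ_Θ = id` (theta type, Prop. 1.5 (i)/(iii)) satisfies `z(c(g)·g) = c(g)·z(g)` for every `g ∈ H′`.
[cite: MochizukiEtTh2009, Rmk 1.10.3 (i) p.31] -/
theorem shear_pullback_apply {H' : Subgroup D.GtpTheta} (hle : D.DeltaTheta ≤ H') {c : D.GtpTheta → D.DeltaTheta}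
    {z : H' → D.DeltaTheta} (hz : z ∈ contCocycles (MonoidHom.id D.GtpTheta) D.DeltaTheta H')
    (htheta : ∀ (δ : D.GtpTheta) (hδ : δ ∈ D.DeltaTheta), z ⟨δ, hle hδ⟩ = ⟨δ, hδ⟩) (g : H') :
    z ⟨(c g : D.GtpTheta) * g, H'.mul_mem (hle (c g).2) g.2⟩ = c g * z g := by
  have hsplit : (⟨(c g : D.GtpTheta) * g, H'.mul_mem (hle (c g).2) g.2⟩ : H') = ⟨(c g : D.GtpTheta), hle (c g).2⟩ * g := rfl
  rw [hsplit, ((mem_contCocycles_iff _).1 hz).2, htheta _ (c g).2]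
  congr 1
  apply Subtype.ext
  rw [MulAut.conjNormal_apply, MonoidHom.id_apply]
  change (c g : D.GtpTheta) * (z g : D.GtpTheta) * ((c g : D.GtpTheta))⁻¹ = (z g : D.GtpTheta)
  rw [D.deltaTheta_comm_of_mem (c g).2 (z g).2, mul_inv_cancel_right]

/-- The restriction of a global cocycle `c` to `H′` is a cocycle on `H′` (same conjugation action).
[cite: NeukirchSchmidtWingberg2008, I §2 and II §7] -/
theorem restrict_mem_contCocycles {c : D.GtpTheta → D.DeltaTheta} (hc : Continuous c)
    (hmul : ∀ g h : D.GtpTheta, c (g * h) = c g * MulAut.conjNormal g (c h)) (H' : Subgroup D.GtpTheta) :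
    (fun g : H' => c g) ∈ contCocycles (MonoidHom.id D.GtpTheta) D.DeltaTheta H' :=
  (mem_contCocycles_iff _).2 ⟨hc.comp continuous_subtype_val, fun g h => hmul g h⟩

/-- **The pulled-back cocycle IS the product `c|H′ · z`** — hence a cocycle, and at the level of classes
`[φ_c^* z] = [c|H′]·[z]` in `H¹(H′, Δ_Θ)` (`ContH1.mk` is multiplicative). [cite: MochizukiEtTh2009, Rmk 1.10.3 (i) p.31] -/
theorem shear_pullback_eq_mul {H' : Subgroup D.GtpTheta} (hle : D.DeltaTheta ≤ H') {c : D.GtpTheta → D.DeltaTheta}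
    (hc : Continuous c) (hmul : ∀ g h : D.GtpTheta, c (g * h) = c g * MulAut.conjNormal g (c h))
    {z : H' → D.DeltaTheta} (hz : z ∈ contCocycles (MonoidHom.id D.GtpTheta) D.DeltaTheta H')
    (htheta : ∀ (δ : D.GtpTheta) (hδ : δ ∈ D.DeltaTheta), z ⟨δ, hle hδ⟩ = ⟨δ, hδ⟩) :
    (fun g : H' => z ⟨(c g : D.GtpTheta) * g, H'.mul_mem (hle (c g).2) g.2⟩) = (fun g : H' => c g) * z ∧
      ∃ hpull : (fun g : H' => z ⟨(c g : D.GtpTheta) * g, H'.mul_mem (hle (c g).2) g.2⟩) ∈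
          contCocycles (MonoidHom.id D.GtpTheta) D.DeltaTheta H',
        ContH1.mk _ hpull = ContH1.mk _ (D.restrict_mem_contCocycles hc hmul H') * ContH1.mk z hz := by
  have heq : (fun g : H' => z ⟨(c g : D.GtpTheta) * g, H'.mul_mem (hle (c g).2) g.2⟩) = (fun g : H' => c g) * z :=
    funext fun g => D.shear_pullback_apply hle hz htheta g
  refine ⟨heq, ?_⟩
  have hmem : (fun g : H' => c g) * z ∈ contCocycles (MonoidHom.id D.GtpTheta) D.DeltaTheta H' :=
    Subgroup.mul_mem _ (D.restrict_mem_contCocycles hc hmul H') hz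
  refine ⟨heq ▸ hmem, ?_⟩
  have : ContH1.mk ((fun g : H' => c g) * z) hmem =
      ContH1.mk _ (D.restrict_mem_contCocycles hc hmul H') * ContH1.mk z hz := rfl
  convert this using 2

/-- **[EtTh] Rmk. 1.10.3 (i) — THE NO-GO FOR THE THETA QUOTIENT.**  For every continuous `Δ_Θ`-valued cocycle `c` on `(Π^tp_X)^Θ`
trivial on `Δ_Θ` there is an automorphism `φ` of the topological group `(Π^tp_X)^Θ`, equal to the identity on `Δ_Θ` and modulo `Δ_Θ`
(so invisible to the quotient `(Π^tp_X)^ell`, to `Δ_Θ`, and preserving every `H′ ⊇ Δ_Θ`), whose pull-back MULTIPLIES every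
theta-type cocycle on every `H′ ⊇ Δ_Θ` by `c`: `z ∘ φ = c·z`.  With `[c|(Π^tp_Ÿ)^Θ]` the Kummer class of a unit `u` of infinite
order this reads `η̈^Θ ↦ (u·η̈)^Θ`, `u ≠ ±1` — the «determined up to ±1» rigidity of Thm. 1.10 (i) has no analogue for the theta
quotient, exactly as the Remark says. [cite: MochizukiEtTh2009, Rmk 1.10.3 (i) p.31] -/
theorem rmk1103i_noGo {c : D.GtpTheta → D.DeltaTheta} (hc : Continuous c)
    (hmul : ∀ g h : D.GtpTheta, c (g * h) = c g * MulAut.conjNormal g (c h))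
    (htriv : ∀ δ : D.GtpTheta, δ ∈ D.DeltaTheta → c δ = 1) :
    ∃ φ : D.GtpTheta ≃ₜ* D.GtpTheta,
      (∀ δ ∈ D.DeltaTheta, φ δ = δ) ∧ (∀ g, φ g * g⁻¹ ∈ D.DeltaTheta) ∧
      ∀ (H' : Subgroup D.GtpTheta) (hle : D.DeltaTheta ≤ H'),
        (∀ g ∈ H', φ g ∈ H') ∧
        ∀ (z : H' → D.DeltaTheta), z ∈ contCocycles (MonoidHom.id D.GtpTheta) D.DeltaTheta H' →
          (∀ (δ : D.GtpTheta) (hδ : δ ∈ D.DeltaTheta), z ⟨δ, hle hδ⟩ = ⟨δ, hδ⟩) →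
          ∀ (g : H') (hg : φ g ∈ H'), z ⟨φ g, hg⟩ = c g * z g := by
  obtain ⟨φ, hφ, hfix, hmod⟩ := D.exists_shear hc hmul htriv
  refine ⟨φ, hfix, hmod, fun H' hle => ⟨fun g hg => ?_, fun z hz htheta g hg => ?_⟩⟩
  · rw [hφ]; exact H'.mul_mem (hle (c g).2) hg
  · have h := D.shear_pullback_apply (c := c) hle hz htheta g
    have hg' : (⟨φ g, hg⟩ : H') = ⟨(c g : D.GtpTheta) * g, H'.mul_mem (hle (c g).2) g.2⟩ := Subtype.ext (hφ g)
    rw [hg']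
    exact h

/-- **Corollary (the Remark's sentence in class currency).**  If two theta-type classes on `H′ ⊇ Δ_Θ` differ by the restriction of a
global `Δ_Θ`-trivial cocycle `c` — e.g. `η̈^Θ` and `(u·η̈)^Θ` for a unit `u` whose Kummer class is `[c]` — then an automorphism of the
topological group `(Π^tp_X)^Θ` (trivial on and modulo `Δ_Θ`) carries the one to the other: no «up to ±1» uniqueness can be read off the
theta quotient.  Stated for representatives: the pulled-back cocycle of `z` along the shear is `c|H′·z`, a cocycle whose class is
`[c|H′]·[z]`. [cite: MochizukiEtTh2009, Rmk 1.10.3 (i) p.31] -/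
theorem rmk1103i_noGo_class {H' : Subgroup D.GtpTheta} (hle : D.DeltaTheta ≤ H') {c : D.GtpTheta → D.DeltaTheta}
    (hc : Continuous c) (hmul : ∀ g h : D.GtpTheta, c (g * h) = c g * MulAut.conjNormal g (c h))
    (htriv : ∀ δ : D.GtpTheta, δ ∈ D.DeltaTheta → c δ = 1)
    {z : H' → D.DeltaTheta} (hz : z ∈ contCocycles (MonoidHom.id D.GtpTheta) D.DeltaTheta H')
    (htheta : ∀ (δ : D.GtpTheta) (hδ : δ ∈ D.DeltaTheta), z ⟨δ, hle hδ⟩ = ⟨δ, hδ⟩) :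
    ∃ (φ : D.GtpTheta ≃ₜ* D.GtpTheta) (hH : ∀ g ∈ H', φ g ∈ H'),
      (∀ δ ∈ D.DeltaTheta, φ δ = δ) ∧ (∀ g, φ g * g⁻¹ ∈ D.DeltaTheta) ∧
      ∃ hpull : (fun g : H' => z ⟨φ g, hH g g.2⟩) ∈ contCocycles (MonoidHom.id D.GtpTheta) D.DeltaTheta H',
        ContH1.mk _ hpull = ContH1.mk _ (D.restrict_mem_contCocycles hc hmul H') * ContH1.mk z hz := by
  obtain ⟨φ, hφ, hfix, hmod⟩ := D.exists_shear hc hmul htriv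
  have hH : ∀ g ∈ H', φ g ∈ H' := fun g hg => by rw [hφ]; exact H'.mul_mem (hle (c g).2) hg
  obtain ⟨heq, hpull, hclass⟩ := D.shear_pullback_eq_mul hle hc hmul hz htheta
  have hfun : (fun g : H' => z ⟨φ g, hH g g.2⟩) =
      (fun g : H' => z ⟨(c g : D.GtpTheta) * g, H'.mul_mem (hle (c g).2) g.2⟩) :=
    funext fun g => congrArg z (Subtype.ext (hφ g))
  refine ⟨φ, hH, hfix, hmod, hfun ▸ hpull, ?_⟩
  convert hclass using 2

end ThetaSetting

end Literature.AnabelianGeometry.EtaleTheta
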